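import Literature.NumberTheory.Automorphic.LocalConstantsUniqueness
import Literature.NumberTheory.GaloisRepresentations.WeilDeligneRepProofs
import HarnessLib

/-!
# Stub `stub_eulerFactor_prod` for line `Sketch_18745_r1_k1` (crux stmt-Langlands-18745)

W2-B: **the Euler factor of a direct sum of Weil–Deligne representations is the product of the
Euler factors**, `L(r ⊕ r', T)⁻¹ = L(r, T)⁻¹ · L(r', T)⁻¹`, i.e.
`det(1 - T · (ρ ⊕ ρ')(Φ) | (ker (N ⊕ N'))^{I_F})`
`= det(1 - T · ρ(Φ) | (ker N)^{I_F}) · det(1 - T · ρ'(Φ) | (ker N')^{I_F})`.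

Proof.  For the direct sum `r.prod r'` on `V × V'` (`WeilDeligneRep.prod`: `ρ ⊕ ρ'`,
`N ⊕ N'`) the subspace `(ker (N ⊕ N'))^{I_F}` is the product submodule
`(ker N)^{I_F} × (ker N')^{I_F}` (`eulerProd_inertiaInvariantsKerN_eq`: membership is
`N v = 0 ∧ ρ(I_F) v = v`, computed coordinatewise).  The injective linear map
`(ker N)^{I_F} × (ker N')^{I_F} ↪ V × V'` (product of the two inclusions) therefore induces a
linear equivalence onto `(ker (N ⊕ N'))^{I_F}` (Mathlib `LinearEquiv.ofInjective`,
`LinearEquiv.ofEq`) which conjugates `ρ(w)| × ρ'(w)|` (`LinearMap.prodMap`) to `(ρ ⊕ ρ')(w)|`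
(`eulerProd_conj_restrictInertiaInvariantsKerN`), so the characteristic polynomial of the
restricted Frobenius of `r ⊕ r'` is the product of those of `r` and `r'`
(`eulerProd_charpoly_restrictInertiaInvariantsKerN`; Mathlib `LinearEquiv.charpoly_conj`,
`LinearMap.charpoly_prodMap`).  The Euler factor is the reversed
characteristic polynomial of the restricted geometric Frobenius
(`WeilDeligneRep.eulerFactor_eq_reverse_charpoly`) and `reverse` is multiplicative over the
domain `ℂ[X]` (`Polynomial.reverse_mul_of_domain`).  Tate, *Number theoretic background*
(Corvallis 1979), (4.1.6); Deligne, Antwerp II (1973), §8.12.  No definitions, no new hypotheses.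
-/

set_option linter.dupNamespace false -- `Summit.Langlands.Langlands` is the mandated namespace

noncomputable section

open Module Literature.NumberTheory.Automorphic Literature.NumberTheory.GaloisRepresentations

namespace Summit.Langlands.Langlands.Theorems.ReciprocityRigidity

variable {F : Type} [Field F] [ValuativeRel F] [TopologicalSpace F] [IsNonarchimedeanLocalField F]

section General

variable {C : Type*} [Field C] [CharZero C] {V : Type*} [AddCommGroup V] [Module C V]
  {V' : Type*} [AddCommGroup V'] [Module C V']

/-- For the direct sum `r ⊕ r'` on `V × V'`, the subspace `(ker (N ⊕ N'))^{I_F}` is the product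
submodule `(ker N)^{I_F} × (ker N')^{I_F}`: both memberships read
`N v = 0 ∧ ∀ u ∈ I_F, ρ(u) v = v`, coordinatewise. [cite: TateCorvallis1979, (4.1.6)] -/
theorem eulerProd_inertiaInvariantsKerN_eq (r : WeilDeligneRep F C V)
    (r' : WeilDeligneRep F C V') :
    (r.prod r').inertiaInvariantsKerN = r.inertiaInvariantsKerN.prod r'.inertiaInvariantsKerN := by
  ext v
  simp only [WeilDeligneRep.mem_inertiaInvariantsKerN_iff, Submodule.mem_prod,
    WeilDeligneRep.prod_N, WeilDeligneRep.prod_ρ_apply, LinearMap.prodMap_apply, Prod.ext_iff,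
    Prod.fst_zero, Prod.snd_zero]
  exact ⟨fun h => ⟨⟨h.1.1, fun u hu => (h.2 u hu).1⟩,
      ⟨h.1.2, fun u hu => (h.2 u hu).2⟩⟩,
    fun h => ⟨⟨h.1.1, h.2.1⟩, fun u hu => ⟨h.1.2 u hu, h.2.2 u hu⟩⟩⟩

/-- The product of the inclusions `(ker N)^{I_F} ↪ V`, `(ker N')^{I_F} ↪ V'` is injective.
[folklore] -/
theorem eulerProd_injective_subtypeProdMap (r : WeilDeligneRep F C V)
    (r' : WeilDeligneRep F C V') :
    Function.Injective
      (r.inertiaInvariantsKerN.subtype.prodMap r'.inertiaInvariantsKerN.subtype) := by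
  intro x y h
  rw [LinearMap.prodMap_apply, LinearMap.prodMap_apply, Prod.mk.injEq] at h
  exact Prod.ext (Subtype.ext h.1) (Subtype.ext h.2)

/-- The range of the product of the inclusions `(ker N)^{I_F} ↪ V`, `(ker N')^{I_F} ↪ V'` is
`(ker (N ⊕ N'))^{I_F}`. [cite: TateCorvallis1979, (4.1.6)] -/
theorem eulerProd_range_subtypeProdMap (r : WeilDeligneRep F C V)
    (r' : WeilDeligneRep F C V') :
    LinearMap.range (r.inertiaInvariantsKerN.subtype.prodMap r'.inertiaInvariantsKerN.subtype) =
      (r.prod r').inertiaInvariantsKerN := by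
  rw [LinearMap.range_prodMap, Submodule.range_subtype, Submodule.range_subtype,
    eulerProd_inertiaInvariantsKerN_eq]

/-- The linear equivalence `(ker N)^{I_F} × (ker N')^{I_F} ≃ (ker (N ⊕ N'))^{I_F}` induced by
the two inclusions conjugates `ρ(w)|_{(ker N)^{I_F}} × ρ'(w)|_{(ker N')^{I_F}}` to
`(ρ ⊕ ρ')(w)|_{(ker (N ⊕ N'))^{I_F}}`. [cite: TateCorvallis1979, (4.1.6)] -/
theorem eulerProd_conj_restrictInertiaInvariantsKerN (hn : absInertia_normal F)
    (r : WeilDeligneRep F C V) (r' : WeilDeligneRep F C V') (w : WeilGroup F) :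
    ((LinearEquiv.ofInjective _ (eulerProd_injective_subtypeProdMap r r')).trans
        (LinearEquiv.ofEq _ _ (eulerProd_range_subtypeProdMap r r'))).conj
      ((r.restrictInertiaInvariantsKerN hn w).prodMap (r'.restrictInertiaInvariantsKerN hn w)) =
      (r.prod r').restrictInertiaInvariantsKerN hn w := by
  set e := (LinearEquiv.ofInjective _ (eulerProd_injective_subtypeProdMap r r')).trans
    (LinearEquiv.ofEq _ _ (eulerProd_range_subtypeProdMap r r')) with he
  have hcoe : ∀ y, (e y : V × V') = ((y.1 : V), (y.2 : V')) := fun y => by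
    rw [he, LinearEquiv.trans_apply, LinearEquiv.coe_ofEq_apply, LinearEquiv.ofInjective_apply,
      LinearMap.prodMap_apply, Submodule.subtype_apply, Submodule.subtype_apply]
  refine LinearMap.ext fun x => ?_
  obtain ⟨y, rfl⟩ := e.surjective x
  rw [LinearEquiv.conj_apply_apply, LinearEquiv.symm_apply_apply]
  refine Subtype.ext ?_
  rw [hcoe, WeilDeligneRep.coe_restrictInertiaInvariantsKerN_apply, hcoe, LinearMap.prodMap_apply,
    WeilDeligneRep.coe_restrictInertiaInvariantsKerN_apply,
    WeilDeligneRep.coe_restrictInertiaInvariantsKerN_apply, WeilDeligneRep.prod_ρ_apply,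
    LinearMap.prodMap_apply]

variable [FiniteDimensional C V] [FiniteDimensional C V']

/-- **Block-diagonal restricted Frobenius.**  The characteristic polynomial of
`(ρ ⊕ ρ')(w)|_{(ker (N ⊕ N'))^{I_F}}` is the product of the characteristic polynomials of
`ρ(w)|_{(ker N)^{I_F}}` and `ρ'(w)|_{(ker N')^{I_F}}` (Mathlib `LinearEquiv.charpoly_conj`,
`LinearMap.charpoly_prodMap`). [cite: TateCorvallis1979, (4.1.6)] -/
theorem eulerProd_charpoly_restrictInertiaInvariantsKerN (hn : absInertia_normal F)
    (r : WeilDeligneRep F C V) (r' : WeilDeligneRep F C V') (w : WeilGroup F) :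
    ((r.prod r').restrictInertiaInvariantsKerN hn w).charpoly =
      (r.restrictInertiaInvariantsKerN hn w).charpoly *
        (r'.restrictInertiaInvariantsKerN hn w).charpoly := by
  rw [← eulerProd_conj_restrictInertiaInvariantsKerN hn r r' w, LinearEquiv.charpoly_conj,
    LinearMap.charpoly_prodMap]

end General

/-- **Stub W2-B: the Euler factor of a direct sum is the product of the Euler factors.**
For Weil–Deligne representations `r, r'` on finite-dimensional complex spaces `V, V'`, the Euler
factor `det(1 - T · (ρ ⊕ ρ')(Φ) | (ker (N ⊕ N'))^{I_F})` of the direct sum `r.prod r'` on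
`V × V'` is `det(1 - T · ρ(Φ) | (ker N)^{I_F}) · det(1 - T · ρ'(Φ) | (ker N')^{I_F})`:
`(ker (N ⊕ N'))^{I_F} = (ker N)^{I_F} × (ker N')^{I_F}` with the Frobenius acting
block-diagonally (`eulerProd_charpoly_restrictInertiaInvariantsKerN`), the Euler factor is the
reversed characteristic polynomial of the restricted geometric Frobenius
(`WeilDeligneRep.eulerFactor_eq_reverse_charpoly`), and `reverse` is multiplicative over `ℂ[X]`
(`Polynomial.reverse_mul_of_domain`).
Ref: Tate, *Number theoretic background* (Corvallis 1979), (4.1.6); Deligne, Antwerp II, §8.12.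
[cite: TateCorvallis1979, (4.1.6)] -/
theorem stub_eulerFactor_prod (hn : absInertia_normal F) (hex : @exists_isFrobPow F _ _ _ _)
    {V : Type*} [AddCommGroup V] [Module ℂ V] [FiniteDimensional ℂ V]
    {V' : Type*} [AddCommGroup V'] [Module ℂ V'] [FiniteDimensional ℂ V']
    (r : WeilDeligneRep F ℂ V) (r' : WeilDeligneRep F ℂ V') :
    (r.prod r').eulerFactor hn hex = r.eulerFactor hn hex * r'.eulerFactor hn hex := by
  rw [(r.prod r').eulerFactor_eq_reverse_charpoly hn hex (WeilDeligneRep.deg_geomFrob' hex),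
    r.eulerFactor_eq_reverse_charpoly hn hex (WeilDeligneRep.deg_geomFrob' hex),
    r'.eulerFactor_eq_reverse_charpoly hn hex (WeilDeligneRep.deg_geomFrob' hex),
    eulerProd_charpoly_restrictInertiaInvariantsKerN hn r r' (WeilDeligneRep.geomFrob F hex),
    Polynomial.reverse_mul_of_domain]

end Summit.Langlands.Langlands.Theorems.ReciprocityRigidity
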